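import Summits.BirchSwinnertonDyer.BirchSwinnertonDyer.Theses.CountingDoorF2AtThree
import Summits.BirchSwinnertonDyer.BirchSwinnertonDyer.Theorems.CountingDoorKernelAtThree
import Summits.BirchSwinnertonDyer.BirchSwinnertonDyer.Theorems.CountingDoorF2AtThreeGenericMembers
import Summits.BirchSwinnertonDyer.BirchSwinnertonDyer.Theorems.CountingDoorF2AtThreeCountingBridge
import HarnessLib

/-!
# BirchSwinnertonDyer / CountingDoorF2AtThree — the join, with the two CLOSED support items discharged
# (helper for the assembly item stmt-BirchSwinnertonDyer-19447)

Route `route-BirchSwinnertonDyer-CountingDoorF2AtThree` (cell bsd-rank2; TWIN-axis leaf T-r2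
`PAdicBSDRankTwoPositiveProportion`, rev 6). The route's deciding theorem `closes` has eight
binders: the two published-input packs `PublishedInputsAtThree` (Schneider 1985 / Perrin-Riou,
Mazur–Tate `σ`, Dokchitser–Dokchitser `3`-parity, Skinner–Urban at `3`) and `LargeFamilyInputsF2`
(Bhargava–Ho 2022 Thm. 10.1 and Thm. 9.1), the three support items `DoorKernelAtThree`,
`GenericMembersLargeF2`, `CountingBridge` — all three PROVED (`Theorems.doorKernelAtThree`,
`Theorems.genericMembersLargeF2`, `Theorems.countingBridge`) — and the three cruxes I1
`SelmerThreeAverageLargeF2`, I2 `RootNumberPlusLowerDensityLargeF2`, I4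
`SchneiderDensityOneAtThree`. This file substitutes the three proved support items into the bridge:
what remains is exactly "published inputs → large-family inputs → I1 → I2 → I4 → leaf".

The assembly item as typed in rev 6, `Assembly := I1 → I2 → I4 → leaf`, omits the two fact packs;
it is therefore provable only MODULO `PublishedInputsAtThree ∧ LargeFamilyInputsF2` (neither is a
tree theorem: Skinner–Urban's main conjecture and Bhargava–Ho's counts are cited, not proved). The
theorem below is the honest closed form; if the assembly item is re-typed to carry the fact packs as
antecedents (the pattern of `Theses.EisensteinPrimes.Assembly`, whose `PublishedInputs` is a
hypothesis of the join itself), it closes by `unfold Assembly; exact leaf_of_cruxes_of_inputs`.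
PARTITION: none — r_an ≥ 2, summit axis S0; TWIN (D-0056): n/a. B1 honesty: term-level glue of
landed tree theorems modulo published inputs; nothing here reads an analytic rank.
-/

set_option linter.dupNamespace false

namespace Summit.BirchSwinnertonDyer.BirchSwinnertonDyer.Theorems

open Summit.BirchSwinnertonDyer.BirchSwinnertonDyer.Theses.CountingDoorF2AtThree

/-- **The join of route `CountingDoorF2AtThree` with its proved support items discharged**: the
published inputs at `3`, the large-family inputs, and the three cruxes I1 (average `#Sel₃ ≤ 36` on
large `Φ ⊆ F₂`), I2 (root number `+1` with lower density `> 1/6`) and I4 (density-one Schneider at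
`3`) imply the TWIN leaf `PAdicBSDRankTwoPositiveProportion` — `Theorems.countingBridge` fed with
`Theorems.doorKernelAtThree` and `Theorems.genericMembersLargeF2`.
[cite: BhargavaShankarTernary2015, §1 (first-moment method with parity)]
[cite: BhargavaHo2022, Thm. 10.1 (§10, p. 35) and Thm. 9.1 (§9.1, p. 31)] -/
theorem leaf_of_cruxes_of_inputs :
    PublishedInputsAtThree → LargeFamilyInputsF2 → SelmerThreeAverageLargeF2 →
      RootNumberPlusLowerDensityLargeF2 → SchneiderDensityOneAtThree →
        PAdicBSDRankTwoPositiveProportion :=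
  fun hIn hL ↦ countingBridge hIn hL doorKernelAtThree genericMembersLargeF2

/-- **The assembly item of route `CountingDoorF2AtThree` holds** (stmt-BirchSwinnertonDyer-19610
`Assembly`, restated in rev 8 to carry the two published-input packs as antecedents, the pattern of
`Theses.EisensteinPrimes.Assembly`):
published inputs at `3` → large-family inputs → I1 → I2 → I4 → the TWIN leaf
`PAdicBSDRankTwoPositiveProportion`; this is `leaf_of_cruxes_of_inputs` after unfolding.
[cite: BhargavaShankarTernary2015, §1 (first-moment method with parity)]
[cite: BhargavaHo2022, Thm. 10.1 (§10, p. 35) and Thm. 9.1 (§9.1, p. 31)] -/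
theorem countingDoorF2AtThree_assembly_proof :
    Summit.BirchSwinnertonDyer.BirchSwinnertonDyer.Theses.CountingDoorF2AtThree.Assembly := by
  unfold Summit.BirchSwinnertonDyer.BirchSwinnertonDyer.Theses.CountingDoorF2AtThree.Assembly
  exact leaf_of_cruxes_of_inputs

end Summit.BirchSwinnertonDyer.BirchSwinnertonDyer.Theorems
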